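import Literature.AnabelianGeometry.SemiGraphs.TemperedLevelStability
import Literature.AnabelianGeometry.SemiGraphs.TemperedPiLevelObjects
import HarnessLib

/-!
# [SemiAnbd] Thm 5.4 producer row T54-B, residual E1 CLOSED for stable towers: the levels `ker ρ_n` of
# abc-iut-L3-t9's Galois tower are stable under `π₁^temp(𝒢) ⋊^out Π_A` as soon as the coverings
# `𝒢_{∞,n}` are stable under the graph action

Mochizuki, *Semi-graphs of anabelioids*, Publ. RIMS **42** (2006), §5 Def 5.1 (i) p. 62, Prop 5.2 (i)
p. 63 ("Every tempered covering of `𝒢` appears as the geometric component of a tempered covering of `𝔊`"),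
Prop 5.2 (iv) p. 64, proof of Thm 5.4 p. 66 [cite: MochizukiSemiAnbd2006, Prop 5.2 (iv), p. 64].

PROOF-ONLY assembly (no definitions; seat abc-iut-L3-t9) of `TemperedLevelStability.lean` (the reduction
`hK ⟸ F^*`-stability of the level objects, any chart) with `TemperedPiLevelObjects.lean` (for the chart
`𝒢.temperedPiChart h36`: the chart image of `𝒢_{∞,n} = 𝒢.coverT h36 n` is transitive with base-point
stabiliser `ker ρ_n`).  RESULT (`ker_proj_stable_of_btempPullback_isos`): for the outer action `ρ` on
`π₁^temp(𝒢) = 𝒢.temperedPi h36` of a pseudo-functorial graph action `F : Π_A → Hom 𝒢 𝒢` (the per-`a`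
representative data of `ArithOuterActionOfGraphAction.exists_outerAction_of_graphAction`), IF every level
covering is `F`-stable — `F_a^*(𝒢_{∞,n}) ≅ 𝒢_{∞,n}` in `B^temp(𝒢)` for all `a`, `n` — THEN

  `∀ n (e : π₁^temp(𝒢) ⋊^out_ρ Π_A) x, x ∈ ker ρ_n → (e.1.1) x ∈ ker ρ_n`,

i.e. the binder `hK` of abc-iut-L3-d4's `GaloisLevelData.arithTreeAct` (`ArithTreeTower.lean`; there
`D.projAut n = D.proj n` definitionally) HOLDS for `D = 𝒢.galoisLevelData h36`, `Φ e := e.1.1`.  Also the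
`∃ ρ` form from the graph action alone (`exists_outerAction_ker_proj_stable_of_graphAction`).

Remaining producer debt of T54-B on this axis (stated, not hidden): an `F`-STABLE cofinal tower, i.e.
Galois level data whose coverings `𝒢_{∞,n}` satisfy the displayed hypothesis — print's Prop 5.2 (i), where
the finiteness conditions of Def 5.1 (i) enter; abc-iut-L3-t9's `galoisLevelData h36` makes arbitrary
choices (`galoisTower` over the Galois-countability family) and is not `F`-stable in general.  Nothing
here refers to the IUT corpus; no side is taken on [IUTchIII] Cor 3.12; typed ≠ proved.
-/

namespace Literature.AnabelianGeometry.SemiGraphs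

namespace ProfiniteSemiGraph

open CategoryTheory Literature.AnabelianGeometry.EtaleTheta

universe u w

variable (𝒢 : ProfiniteSemiGraph.{u}) (h36 : 𝒢.Prop36Hypotheses) {PA : Type w} [Group PA]
  (F : PA → Hom 𝒢 𝒢)

/-- **E1 for stable towers**: if every level covering `𝒢_{∞,n}` of the tower is `F_a^*`-stable then the
levels `ker ρ_n ⊆ π₁^temp(𝒢)` are stable under the automorphism components of ALL elements of
`π₁^temp(𝒢) ⋊^out_ρ Π_A` — the binder `hK` of the arithmetic tree actions.
[cite: MochizukiSemiAnbd2006, Prop 5.2 (iv), p. 64] -/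
theorem ker_proj_stable_of_btempPullback_isos (ρ : PA →* TopOut (𝒢.temperedPiChart h36).G)
    (hρ : ∀ a, ∃ (Φ : contMulAut (𝒢.temperedPiChart h36).G)
      (φ : (𝒢.temperedPiChart h36).G →ₜ* (𝒢.temperedPiChart h36).G),
      TopOut.mk _ Φ = ρ a ∧ (∀ t, (Φ : MulAut (𝒢.temperedPiChart h36).G) t = φ t) ∧
        Nonempty ((F a).chartPullback (𝒢.temperedPiChart h36) (𝒢.temperedPiChart h36) ≅ BTemp.res φ))
    (hT : ∀ (a : PA) (n : ℕ), Nonempty ((F a).btempPullback.obj (𝒢.coverT h36 n) ≅ 𝒢.coverT h36 n))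
    (n : ℕ) (e : outerSemidirectProduct ρ) (y : (𝒢.temperedPiChart h36).G)
    (hy : y ∈ ((𝒢.galoisLevelData h36).proj h36.isCountable n).ker) :
    ((e : contMulAut (𝒢.temperedPiChart h36).G × PA).1 : MulAut (𝒢.temperedPiChart h36).G) y ∈
      ((𝒢.galoisLevelData h36).proj h36.isCountable n).ker :=
  levelStable_of_btempPullback_isos (𝒢.temperedPiChart h36) F ρ hρ
    (fun n => ((𝒢.galoisLevelData h36).proj h36.isCountable n).ker) (fun _ => MonoidHom.normal_ker _)
    (fun n => 𝒢.coverT h36 n) hT (fun n => (𝒢.temperedPiChart h36).equiv.functor.obj (𝒢.coverT h36 n))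
    (fun _ => Iso.refl _) (fun n => (𝒢.galoisLevelData h36).bp n) (fun n y => 𝒢.coverT_transitive h36 n y)
    (fun n g => 𝒢.mem_ker_proj_iff_coverT h36 n g) n e y hy

/-- **From the graph action alone**: a pseudo-functorial action of `Π_A` on `𝒢` by morphisms of
semi-graphs of anabelioids under which every level covering `𝒢_{∞,n}` is stable induces an outer action
`ρ` on `π₁^temp(𝒢)` (with the per-`a` representative data feeding the binders `hV`/`hE`/`hBR` of
`ArithOuterActionOfGraphAction.lean`) for which `hK` holds. [cite: MochizukiSemiAnbd2006, Prop 5.2 (iv), p. 64] -/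
theorem exists_outerAction_ker_proj_stable_of_graphAction
    (hmul : ∀ a b, Nonempty ((F (a * b)).chartPullback (𝒢.temperedPiChart h36) (𝒢.temperedPiChart h36) ≅
      (F a).chartPullback (𝒢.temperedPiChart h36) (𝒢.temperedPiChart h36) ⋙
        (F b).chartPullback (𝒢.temperedPiChart h36) (𝒢.temperedPiChart h36)))
    (hone : Nonempty ((F 1).chartPullback (𝒢.temperedPiChart h36) (𝒢.temperedPiChart h36) ≅
      𝟭 (BTemp (𝒢.temperedPiChart h36).G)))
    (hT : ∀ (a : PA) (n : ℕ), Nonempty ((F a).btempPullback.obj (𝒢.coverT h36 n) ≅ 𝒢.coverT h36 n)) :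
    ∃ ρ : PA →* TopOut (𝒢.temperedPiChart h36).G,
      (∀ a, ∃ (Φ : contMulAut (𝒢.temperedPiChart h36).G)
        (φ : (𝒢.temperedPiChart h36).G →ₜ* (𝒢.temperedPiChart h36).G),
        TopOut.mk _ Φ = ρ a ∧ (∀ t, (Φ : MulAut (𝒢.temperedPiChart h36).G) t = φ t) ∧
          Nonempty ((F a).chartPullback (𝒢.temperedPiChart h36) (𝒢.temperedPiChart h36) ≅ BTemp.res φ)) ∧
      ∀ (n : ℕ) (e : outerSemidirectProduct ρ) (y : (𝒢.temperedPiChart h36).G),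
        y ∈ ((𝒢.galoisLevelData h36).proj h36.isCountable n).ker →
          ((e : contMulAut (𝒢.temperedPiChart h36).G × PA).1 : MulAut (𝒢.temperedPiChart h36).G) y ∈
            ((𝒢.galoisLevelData h36).proj h36.isCountable n).ker := by
  obtain ⟨ρ, hρ⟩ := exists_outerAction_of_graphAction (𝒢.temperedPiChart h36) F hmul hone
  exact ⟨ρ, hρ, 𝒢.ker_proj_stable_of_btempPullback_isos h36 F ρ hρ hT⟩

end ProfiniteSemiGraph

end Literature.AnabelianGeometry.SemiGraphs
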